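import Summits.ResolutionOfSingularities.ResolutionOfSingularities.Theorems.EquisingularLiftEquisingularLiftNatHostedRoundSeam
import Summits.ResolutionOfSingularities.ResolutionOfSingularities.Theorems.EquisingularLiftEquisingularLiftNatCrossedLetterTransport
import Summits.ResolutionOfSingularities.ResolutionOfSingularities.Theorems.EquisingularLiftEquisingularLiftNatCurveRoundExceptionalLetter
import HarnessLib

/-!
# [OURS · L1 W4.5(b) · EL♮(3) · WIDTH TABLE D7 «NESTED HOST / KEPT MEMBERS», supplier row HROUND-KEEP] THE HOSTED ROUND THAT KEEPS ITS MEMBERS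
# `TCPlus.hround_keep k hF : <HROUND of ✓ target_elnat_of_letteredPrefixResolution at n := 3, widened: every listed letter steps to its strict transform and the exceptional letter is born>`

res-type-027 g22 (desk R62 (c)/(d): «(HR-KEEP) size word … then RUNGᵉ support»; this is the UPSTAIRS supplier of that size word, items (3)/(4a)).
OURS; NOT a statement of any manuscript ([Hironaka2017] is a candidate under adjudication, nothing of it is asserted); AI-written, weaker than expert
review.  No `sorry`; standard axioms; DEF-FREE; one NAMED-FACT hypothesis `hF : EmbeddedCurveLiftFact` (residue (T-k), exactly as ✓ `TCPlus.hround_seam`).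
`--supports stmt-ResolutionOfSingularities-20148 --as helper`.

WHAT.  ✓ `TCPlus.hround_seam` (res-L1-w45b-stub-2 g15, the HROUND supplier of the K5⁶ engine) matches a HOSTED ROUND — a regular closed curve `Z` inside a listed
host letter `E₁` (model `𝓔`), `Ẽ₁` regular along `Z̃`, `DirStepUnobs` in the host, one-dimensional local rings along `Z̃` — by the `Ch`-stage `Bl_C X'` for
(T-k)'s centre `C ⊇ 𝓔`, and returns ONE letter: the host's strict transform.  Here the SAME round returns, in the output currency of ✓ HPAIR
(`TCPlus.hpair_supplier_of`): a `TCPlus.LetterDatum` for the strict transform `closure (υ'⁻¹(closure L ∖ Z))` of EVERY listed letter `L ∈ Ls`, and one for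
the new exceptional letter `υ'⁻¹ Z`, under the pair clause's «other members» conjuncts for every listed `L ≠ E₁` — downstairs `𝓘⟨cl L⟩ ⊔ 𝓘⟨Z⟩ = 𝓘⟨cl L ∩ Z⟩`
(reduced crossing) and `𝓘⟨cl L⟩_z ⊄ 𝓘⟨Z⟩_z` at the closed points of `Z` (no branch of `Z` inside `cl L`; `Z ∩ cl L = ∅` allowed).  At `Ls := [E₁]` the member
block is vacuous and the conclusion contains ✓ `hround_seam`'s (width (HR)) and the «nested host» output `[St E₁, υ'⁻¹ Z]` (width (HR⁺)).
* `TCPlus.excLetter_birth₀` — ✓ (EB) `TCPlus.excLetter_birth` (res-L1-w45b-stub-2 g16) WITHOUT its unused binders («`X₂` regular», «`C ≠ ⊥`», «`Z̃` regular»,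
  the curve clause, «`G` regular along `Z`», «`υ₂` is the blow-up of `Z`»); proof = (EB)'s, verbatim.  Needed because the hosted-round clause does not carry «`F₁` regular along `Z`».
* `TCPlus.hround_keep k hF` — the widened HROUND binder at `n := 3`.

PROOF (pure composition, no new mathematics).  ✓ `hround_seam`'s body VERBATIM up to the host letter ((T-k) at the host's model with the centre `C` KEPT IN
HAND: reduced trace `C·𝒪_{F₁} = 𝓘⟨Z⟩`, `V(C)` regular, `O`-flat, off `Y` by ✓ `image_support_subset_not_isGenericPoint_of_chain`, the blow-up `τ₃ = Bl_C`
and its model square by ✓ `modelStep_chain`, the 2-frames by ✓ `hFrame_of_ringKrullDim_redSub` — this is where `n = 3` enters —, the host letter by ★ HT2′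
`TCPlus.letterDatum_transport_hostedRound'`); `C ≠ ⊥` because `𝓔 ≤ C` and `𝓔 ≠ ⊥`; every OTHER listed letter by ✓ (CL) `TCPlus.crossedLetter_clauses`
(res-L1-w45b-stub-4 g12 — typed for an ARBITRARY regular `O`-flat centre with reduced trace `𝓘⟨Z⟩`, so (T-k)'s centre qualifies unchanged); the birth by
`excLetter_birth₀`.  No dimension formula along the chain (T-DIM) is used. [folklore; pure composition of ✓ p661929's ingredients, ✓ (CL), ✓ (EB)]
-/

set_option linter.dupNamespace false -- mandated namespace `Summit.<Summit>.<Problem>` of this single-conjunct summit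
set_option linter.overlappingInstances false -- signatures carry `[IsDomain O] [IsDiscreteValuationRing O]`

noncomputable section

open CategoryTheory CategoryTheory.Limits AlgebraicGeometry TopologicalSpace Topology IsLocalRing
open Literature.AlgebraicGeometry.Resolution
open AlgebraicGeometry.Scheme.IdealSheafData
open Summit.ResolutionOfSingularities.ResolutionOfSingularities.Theses.EquisingularLift.Split
open Summit.ResolutionOfSingularities.ResolutionOfSingularities.Cruxes.EquisingularLift.StrataSplit

namespace Summit.ResolutionOfSingularities.ResolutionOfSingularities.Cruxes.EquisingularLiftNat.Sections

/-- **(EB₀) THE EXCEPTIONAL LETTER OF A CURVE ROUND IS BORN WITH THE MODEL `C·𝒪_{X₂}`** — ✓ `TCPlus.excLetter_birth` without its unused binders: in a model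
square `jG : G ⟶ X` over `Spec θ`, for a centre `C` on the regular `X` with `V(C)` regular, `O`-flat, off `Y`, reduced trace `C·𝒪_G = 𝓘⟨Z⟩` and quasi-regular
2-frames on its support, the blow-up `τ = Bl_C`, ANY `υ₂ : G₂ ⟶ G` (in the application `Bl_Z`; its blow-up property is not used) and the new model square
`j₂` (`j₂ ≫ τ = υ₂ ≫ jG`), the exceptional letter `υ₂⁻¹ Z` carries `TCPlus.LetterDatum O P q Y G₂ X₂ (τ ≫ σ) j₂ (υ₂⁻¹ Z)` with model `C.comap τ`.  Proof = (EB)'s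
verbatim. [cite: Liu2002, Thm. 8.1.19]
[OURS · L1 W4.5b · WIDTH TABLE D7, supplier row HROUND-KEEP, input (EB₀)] -/
theorem TCPlus.excLetter_birth₀ (k : Type) [Field k] (O : Type) [CommRing O] [IsDomain O] [IsDiscreteValuationRing O] (θ : O →+* k)
    (hθ : Function.Surjective θ) {P X X₂ G G₂ : Scheme.{0}} (q : P ⟶ Spec (.of O)) (Y : Set P) (σ : X ⟶ P)
    [IsLocallyNoetherian X] [IsIntegral X] [IsLocallyNoetherian X₂] [IsIntegral X₂]
    [IsLocallyNoetherian G] [IsIntegral G] [IsLocallyNoetherian G₂] [IsIntegral G₂] [IsProper (σ ≫ q)]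
    (hXreg : Scheme.IsRegular X) (jG : G ⟶ X) (tG : G ⟶ Spec (.of k)) (hsq : IsPullback jG tG (σ ≫ q) (Spec.map (CommRingCat.ofHom θ)))
    (C : X.IdealSheafData) (Z : Set G) (hZ : IsClosed Z) (hCZ : C.comap jG = vanishingIdeal (⟨Z, hZ⟩ : Closeds G))
    (hCfl : Flat (C.subschemeι ≫ σ ≫ q)) (hCreg : Scheme.IsRegular C.subscheme)
    (hfr : ∀ x ∈ C.support, ∃ c : Fin 2 → X.presheaf.stalk x, Ideal.span (Set.range c) = stalkIdeal C x ∧ IsQuasiRegular c)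
    (hoff : σ '' (C.support : Set X) ⊆ {p : P | ¬ IsGenericPoint p Y})
    {τ : X₂ ⟶ X} (hτ : IsBlowup τ C) {υ₂ : G₂ ⟶ G}
    (j₂ : G₂ ⟶ X₂) (t₂ : G₂ ⟶ Spec (.of k)) (hsq₂ : IsPullback j₂ t₂ ((τ ≫ σ) ≫ q) (Spec.map (CommRingCat.ofHom θ))) (hcomm : j₂ ≫ τ = υ₂ ≫ jG) :
    TCPlus.LetterDatum O P q Y G₂ X₂ (τ ≫ σ) j₂ (υ₂ ⁻¹' Z) := by
  have hZcl : IsClosed (υ₂ ⁻¹' Z) := hZ.preimage υ₂.continuous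
  have hcl : (⟨closure (υ₂ ⁻¹' Z), isClosed_closure⟩ : Closeds G₂) = ⟨υ₂ ⁻¹' Z, hZcl⟩ := Closeds.ext hZcl.closure_eq
  refine ⟨C.comap τ, ?_, isPrincipal_stalkIdeal_comap_of_isBlowup C hτ, hτ.isRegular_subscheme_comap hXreg hCreg,
    image_support_comap_subset C τ σ hoff, ?_⟩
  · -- (l-i) the REDUCED trace: frames upstairs, res-D-pv-029's model-square lemma
    rw [hcl]
    have hsq₂' : IsPullback j₂ t₂ (τ ≫ σ ≫ q) (Spec.map (CommRingCat.ofHom θ)) := by simpa only [Category.assoc] using hsq₂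
    have hqr : ∀ z ∈ ((⟨Z, hZ⟩ : Closeds G) : Set G), ∃ (n : ℕ) (c : Fin n → X.presheaf.stalk (jG z)),
        Ideal.span (Set.range c) = stalkIdeal C (jG z) ∧ IsQuasiRegular c := by
      intro z hz
      have hmem : jG z ∈ C.support := by
        have h1 : z ∈ ((C.comap jG).support : Set G) := by
          rw [hCZ, Scheme.IdealSheafData.coe_support_vanishingIdeal]; exact hz
        rw [support_comap] at h1
        exact h1
      obtain ⟨c, hc, hq⟩ := hfr _ hmem
      exact ⟨2, c, hc, hq⟩
    exact comap_comap_eq_vanishingIdeal_preimage_of_model O k θ hθ (σ ≫ q) jG tG hsq C τ hτ j₂ t₂ hsq₂' υ₂ hcomm ⟨Z, hZ⟩ hCZ hqr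
  · -- (l-v) the exceptional divisor is flat over `O`
    have h := flat_exceptional_of_isBlowup_regularCentre O X X₂ (σ ≫ q) C hXreg hCreg hCfl τ hτ
    simpa only [Category.assoc] using h

/-- **HROUND-KEEP: the hosted-round supplier that keeps its members, at `n = 3`, from (T-k).**  The HROUND binder of the K5⁶ engine with `∀ Ls, (∀ L ∈ Ls,
LetterDatum … L) → E₁ ∈ Ls →` in place of `∀ E₁, LetterDatum … E₁ →`, the pair clause's «other members» block for every listed `L ≠ E₁`, and the output in
HPAIR's currency (every listed letter's strict transform, the exceptional letter born).  See the module docstring. [folklore; pure composition]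
[OURS · L1 W4.5b · WIDTH TABLE D7, supplier row HROUND-KEEP] -/
theorem TCPlus.hround_keep (k : Type) [Field k] [IsAlgClosed k] (hF : EmbeddedCurveLiftFact) :
    ∀ (O : Type) [CommRing O] [IsDomain O] [IsDiscreteValuationRing O] [IsAdicComplete (IsLocalRing.maximalIdeal O) O]
        [IsAlgClosed (IsLocalRing.ResidueField O)] (θ : O →+* k), Function.Surjective θ →
      ∀ (P : AlgebraicGeometry.Scheme.{0}) (q : P ⟶ AlgebraicGeometry.Spec (.of O)) (Y : Set P)
        (Ch : ∀ X' : AlgebraicGeometry.Scheme.{0}, (X' ⟶ P) → Set X' → Prop),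
        (∀ (X' X'' : AlgebraicGeometry.Scheme.{0}) (σ' : X' ⟶ P) (S' : Set X') (C : X'.IdealSheafData) (τ : X'' ⟶ X'),
          Ch X' σ' S' → Literature.AlgebraicGeometry.Resolution.IsBlowup τ C →
          Literature.AlgebraicGeometry.Resolution.Scheme.IsRegular C.subscheme → AlgebraicGeometry.Flat (C.subschemeι ≫ σ' ≫ q) →
          σ' '' (C.support : Set X') ⊆ {y | ¬ IsGenericPoint y Y} →
          (C.support : Set X') ∩ (σ' ≫ q) ⁻¹' {IsLocalRing.closedPoint O} ⊆ S' →
          Ch X'' (τ ≫ σ') (closure (τ ⁻¹' (S' \ (C.support : Set X'))))) →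
        (∀ (X' : AlgebraicGeometry.Scheme.{0}) (σ' : X' ⟶ P) (S' : Set X'), Ch X' σ' S' →
          Summit.ResolutionOfSingularities.ResolutionOfSingularities.Theses.EquisingularLift.Split.Chain P Y X' σ' S') →
        Y ⊆ q ⁻¹' {IsLocalRing.closedPoint O} → IsIrreducible Y → IsClosed Y →
        AlgebraicGeometry.IsIntegral P → IsLocallyNoetherian P → Literature.AlgebraicGeometry.Resolution.Scheme.IsRegular P →
        AlgebraicGeometry.IsProper q → AlgebraicGeometry.SmoothOfRelativeDimension 3 q →
      ∀ (X' : AlgebraicGeometry.Scheme.{0}) (σ' : X' ⟶ P) (S' : Set X'), Ch X' σ' S' → AlgebraicGeometry.IsIntegral X' →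
        IsLocallyNoetherian X' → Literature.AlgebraicGeometry.Resolution.Scheme.IsRegular X' →
        AlgebraicGeometry.IsDominant (σ' ≫ q) →
      ∀ (F₁ : AlgebraicGeometry.Scheme.{0}), AlgebraicGeometry.IsIntegral F₁ → ∀ (j : F₁ ⟶ X')
        (t : F₁ ⟶ AlgebraicGeometry.Spec (.of k)),
        IsPullback j t (σ' ≫ q) (AlgebraicGeometry.Spec.map (CommRingCat.ofHom θ)) →
      ∀ (T₁ : Set F₁), IsClosed T₁ → IsIrreducible T₁ → j '' T₁ = S' →
      ∀ (Ls : List (Set F₁)), (∀ L ∈ Ls, TCPlus.LetterDatum O P q Y F₁ X' σ' j L) →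
      ∀ (E₁ : Set F₁) (Z : Set F₁) (hZ : IsClosed Z) (F₃ : AlgebraicGeometry.Scheme.{0}) (υ' : F₃ ⟶ F₁),
        E₁ ∈ Ls → Z ⊆ closure E₁ → Z ⊆ T₁ → ¬ T₁ ⊆ Z →
        (∀ z : ↥(redSub F₁ Z hZ), IsRegularLocalRing ((redSub F₁ Z hZ).presheaf.stalk z)) →
        (∀ (i : redSub F₁ Z hZ ⟶ redSub F₁ (closure E₁) isClosed_closure), i ≫ redSubι F₁ (closure E₁) isClosed_closure = redSubι F₁ Z hZ →
          ∀ z : ↥(redSub F₁ Z hZ), IsRegularLocalRing ((redSub F₁ (closure E₁) isClosed_closure).presheaf.stalk (i z))) →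
        DirStepUnobs F₁ (closure E₁) isClosed_closure Z hZ →
        (∀ z : ↥(redSub F₁ Z hZ), IsClosed ({z} : Set ↥(redSub F₁ Z hZ)) → ringKrullDim ((redSub F₁ Z hZ).presheaf.stalk z) = ((1 : ℕ) : WithBot ℕ∞)) →
        -- the pair clause's «other members» block: every listed `L ≠ E₁` does not contain `Z` and meets it transversally (possibly not at all)
        (∀ L ∈ Ls, L ≠ E₁ →
          AlgebraicGeometry.Scheme.IdealSheafData.vanishingIdeal (⟨closure L, isClosed_closure⟩ : TopologicalSpace.Closeds F₁) ⊔
              AlgebraicGeometry.Scheme.IdealSheafData.vanishingIdeal (⟨Z, hZ⟩ : TopologicalSpace.Closeds F₁) =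
            AlgebraicGeometry.Scheme.IdealSheafData.vanishingIdeal (⟨closure L ∩ Z, isClosed_closure.inter hZ⟩ : TopologicalSpace.Closeds F₁) ∧
          ∀ z ∈ Z, IsClosed ({z} : Set F₁) →
            ¬ Literature.AlgebraicGeometry.Resolution.stalkIdeal (AlgebraicGeometry.Scheme.IdealSheafData.vanishingIdeal (⟨closure L, isClosed_closure⟩ : TopologicalSpace.Closeds F₁)) z ≤
              Literature.AlgebraicGeometry.Resolution.stalkIdeal (AlgebraicGeometry.Scheme.IdealSheafData.vanishingIdeal (⟨Z, hZ⟩ : TopologicalSpace.Closeds F₁)) z) →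
        Literature.AlgebraicGeometry.Resolution.IsBlowup υ' (AlgebraicGeometry.Scheme.IdealSheafData.vanishingIdeal (⟨Z, hZ⟩ : TopologicalSpace.Closeds F₁)) →
        ∃ (X₉ : AlgebraicGeometry.Scheme.{0}) (σ₉ : X₉ ⟶ P) (S₉ : Set X₉) (j₉ : F₃ ⟶ X₉) (t₉ : F₃ ⟶ AlgebraicGeometry.Spec (.of k)),
          Ch X₉ σ₉ S₉ ∧ AlgebraicGeometry.IsIntegral X₉ ∧ IsLocallyNoetherian X₉ ∧
          Literature.AlgebraicGeometry.Resolution.Scheme.IsRegular X₉ ∧ AlgebraicGeometry.IsDominant (σ₉ ≫ q) ∧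
          IsPullback j₉ t₉ (σ₉ ≫ q) (AlgebraicGeometry.Spec.map (CommRingCat.ofHom θ)) ∧ j₉ '' (closure (υ' ⁻¹' (T₁ \ Z))) = S₉ ∧
          IsClosed (closure (υ' ⁻¹' (T₁ \ Z))) ∧ IsIrreducible (closure (υ' ⁻¹' (T₁ \ Z))) ∧ AlgebraicGeometry.IsIntegral F₃ ∧
          (∀ L ∈ Ls, TCPlus.LetterDatum O P q Y F₃ X₉ σ₉ j₉ (closure (υ' ⁻¹' (closure L \ Z)))) ∧
          TCPlus.LetterDatum O P q Y F₃ X₉ σ₉ j₉ (υ' ⁻¹' Z) := by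
  intro O _ _ _ _ _ θ hθ P q Y Ch hChStep hChSplit hYsp hYirr hYcl hPint hPnoeth hPreg hqprop hqsm X' σ' S' hCh' hX'int hX'noeth hX'reg hX'dom
    F₁ hF₁ j t hsq T₁ hT₁cl hT₁irr hjT₁ Ls hLs E₁ Z hZ F₃ υ' hE₁ hZE hZT hTZ hZreg hEreg hunobs hZdim hOthers hυ'
  classical
  haveI := hPint; haveI := hPnoeth; haveI := hX'int; haveI := hX'noeth; haveI := hF₁; haveI := hqprop; haveI := hqsm
  obtain ⟨𝓔, hEtr, hEpr, hEreg', hEoff, hEfl⟩ := hLs E₁ hE₁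
  -- properness of the stage over `O` (for (T-k)'s properness input)
  have hch : Chain P Y X' σ' S' := hChSplit _ _ _ hCh'
  obtain ⟨-, -, hσ'prop⟩ := chain_isRegular P Y X' σ' S' hch hPnoeth hPreg
  haveI := hσ'prop
  have hEprop : IsProper (𝓔.subschemeι ≫ σ' ≫ q) := inferInstance
  -- the host's model is not `⊥`: (l-iv) and the fibre of the chain over the generic point of `Y`
  have h𝓔0 : 𝓔 ≠ ⊥ := by
    obtain ⟨ξ, hξ⟩ : ∃ ξ : P, IsGenericPoint ξ Y := QuasiSober.sober hYirr hYcl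
    obtain ⟨ξ', hfib', -⟩ := Chain.fibre hch hξ
    intro h0
    have hmem : ξ' ∈ (𝓔.support : Set X') := by rw [h0, Scheme.IdealSheafData.support_bot]; trivial
    have hgen : σ' ξ' = ξ := by
      have : ξ' ∈ σ' ⁻¹' {ξ} := by rw [hfib']; exact Set.mem_singleton ξ'
      exact this
    exact hEoff ⟨ξ', hmem, rfl⟩ (hgen ▸ hξ)
  -- (T-k) AT THE HOST'S MODEL: the centre `C ⊇ 𝓔`, kept in hand
  obtain ⟨C, hEC, hCreg, hCfl, hCj, -⟩ := hF k O θ hθ P q X' σ' 𝓔 hX'int hX'noeth hX'reg hEreg' hEfl hEprop F₁ j t hsq (closure E₁)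
    isClosed_closure hEtr Z hZ hZE hZreg hEreg hunobs
  have hC0 : C ≠ ⊥ := fun h => h𝓔0 (le_bot_iff.mp (h ▸ hEC))
  -- E1-legality of `C` upstairs: off the generic point of `Y`
  have hoff : σ' '' (C.support : Set X') ⊆ {y : P | ¬ IsGenericPoint y Y} :=
    image_support_subset_not_isGenericPoint_of_chain θ hθ q Y hYsp σ' S' hch j t hsq T₁ hjT₁ C Z hZ hCj hTZ
  -- the blow-up of `C`, its `Ch`-stage and the model square for `υ'`
  have hDT : (((vanishingIdeal (⟨Z, hZ⟩ : Closeds F₁)) : F₁.IdealSheafData).support : Set F₁) ⊆ T₁ := by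
    rw [Scheme.IdealSheafData.coe_support_vanishingIdeal]; exact hZT
  have hTD : ¬ T₁ ⊆ (((vanishingIdeal (⟨Z, hZ⟩ : Closeds F₁)) : F₁.IdealSheafData).support : Set F₁) := by
    rw [Scheme.IdealSheafData.coe_support_vanishingIdeal]; exact hTZ
  obtain ⟨X₃, τ₃, hτ₃⟩ := exists_isBlowup X' C
  obtain ⟨hX₃i, hX₃n, hX₃r, hX₃dom, hF₃i, hirr₃, j₃, t₃, hsq₃, hcomm₃, hCh₃⟩ :=
    modelStep_chain O k θ hθ P q Y hYirr hYcl Ch hChSplit hChStep X' σ' S' hCh' hX'reg hX'dom F₁ j t hsq T₁ hjT₁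
      C (vanishingIdeal (⟨Z, hZ⟩ : Closeds F₁)) hCj hCreg hCfl hoff hDT hTD X₃ τ₃ hτ₃ F₃ υ' hυ'
  rw [Scheme.IdealSheafData.coe_support_vanishingIdeal] at hirr₃ hCh₃
  haveI := hX₃n; haveI := hX₃i; haveI := hF₃i
  haveI : IsClosedImmersion (Spec.map (CommRingCat.ofHom θ)) := IsClosedImmersion.spec_of_surjective _ hθ
  haveI hjci : IsClosedImmersion j := MorphismProperty.IsStableUnderBaseChange.of_isPullback hsq.flip inferInstance
  haveI : IsLocallyNoetherian F₁ := LocallyOfFiniteType.isLocallyNoetherian j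
  haveI hj₃ci : IsClosedImmersion j₃ := MorphismProperty.IsStableUnderBaseChange.of_isPullback hsq₃.flip inferInstance
  haveI : IsLocallyNoetherian F₃ := LocallyOfFiniteType.isLocallyNoetherian j₃
  -- the 2-frames of `C` (the curve clause and `n = 3`)
  have hfr : ∀ x ∈ C.support, ∃ c : Fin 2 → X'.presheaf.stalk x, Ideal.span (Set.range c) = stalkIdeal C x ∧ IsQuasiRegular c :=
    hFrame_of_ringKrullDim_redSub O k θ hθ P q Y hYirr hYcl hPnoeth hPreg Ch hChSplit T₁ Z hZ hZdim X' σ' S' j t C hCh' hX'int hX'noeth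
      hX'reg hX'dom hsq hjT₁ hCj hCfl hCreg
  -- the host letter of the strict transform (HT2′)
  have hL₉ : TCPlus.LetterDatum O P q Y F₃ X₃ (τ₃ ≫ σ') j₃ (closure (υ' ⁻¹' (closure E₁ \ Z))) :=
    TCPlus.letterDatum_transport_hostedRound' O k θ hθ q Y σ' hX'reg j t hsq isClosed_closure 𝓔 hEtr hEpr hEreg' hEoff hEfl h𝓔0 C hEC hZ
      hCj hCfl hCreg hfr hτ₃ hυ' j₃ t₃ hsq₃ hcomm₃
  -- EVERY listed letter after the round: the host by HT2′, the others by (CL)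
  have hLs₃ : ∀ L ∈ Ls, TCPlus.LetterDatum O P q Y F₃ X₃ (τ₃ ≫ σ') j₃ (closure (υ' ⁻¹' (closure L \ Z))) := by
    intro L hL
    by_cases hLe : L = E₁
    · subst hLe; exact hL₉
    · obtain ⟨hc1, hc2⟩ := hOthers L hL hLe
      obtain ⟨𝓛, hl1, hl2, hl3, hl4, hl5⟩ := hLs L hL
      obtain ⟨h1, h2, h3, h4, h5⟩ := TCPlus.crossedLetter_clauses k O θ hθ q Y σ' hX'reg hX₃r j t hsq C hZ hCj hCfl hCreg hC0 hZreg hZdim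
        hτ₃ hυ' j₃ t₃ hsq₃ hcomm₃ L 𝓛 hl1 hl2 hl3 hl4 hl5 hc1 hc2
      refine ⟨strictTransformIdeal τ₃ C 𝓛, ?_, h2, h3, h4, h5⟩
      rw [h1]
      congr 1
      exact Closeds.ext closure_closure.symm
  -- THE BIRTH of the exceptional letter (EB₀)
  have hE₃ : TCPlus.LetterDatum O P q Y F₃ X₃ (τ₃ ≫ σ') j₃ (υ' ⁻¹' Z) :=
    TCPlus.excLetter_birth₀ k O θ hθ q Y σ' hX'reg j t hsq C Z hZ hCj hCfl hCreg hfr hoff hτ₃ j₃ t₃ hsq₃ hcomm₃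
  exact ⟨X₃, τ₃ ≫ σ', _, j₃, t₃, hCh₃, hX₃i, hX₃n, hX₃r, hX₃dom, hsq₃, rfl, isClosed_closure, hirr₃, hF₃i, hLs₃, hE₃⟩

end Summit.ResolutionOfSingularities.ResolutionOfSingularities.Cruxes.EquisingularLiftNat.Sections

end
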